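/-
Origin: expansion seat `prover-pub-hodgecm-mc-sinst-1-g5-0`, handover #1221 2026-08-20T09:49Z md5 54072eabf46a (141 l., 7 decls) NEW additive leaf; ROWDEPS #1219 + #1220 (install after both; drop with either); (VT) assembled: the archimedean factor of an implementer of h₀ = π(s h)·m (m Levi-shaped) is c • ω_∞(h) ∘ (Φ ↦ Φ ∘ P⁻¹); NAME LIST: HodgeCM.Model.ArchLevi.exists_archFactor_eq_smul_archRepMp_compCLE · HodgeCM.Model.ArchLevi.compCLE_covariant_archPhaseMap · HodgeCM.Model.ArchLevi.exists_archFactor_eq_smul_archRepMp_compCLE_ne_zero (`HOME/mc/pub-hodgecm-mc-sinst-1-g5/stage/HodgeCM/Model/ArchLeviFactorization.lean`, md5 54072eabf46a, 141 lines);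
landed by the gen-18 packager (p-g18) in gate run 47 as `HodgeCM/Model/ArchLeviFactorization.lean` (verbatim).
-/
/-
Origin: speedrun cell pub-hodgecm, MODEL-CONSTRUCTION sub-cell, lineage mc-sinst-1 (S-instance constructor, BINDER-OWNERS row 5 `S` / row 6 `μ`: (J-μ) slots 2/3,
(VT) items W4 + W5 of `mc/pub-hodgecm-mc-period-1-g14/notes/STRIP-SCOPE.g14.md`, assembled), seat prover-pub-hodgecm-mc-sinst-1-g5-0 (gen 5), 2026-08-20.
Target in PKG: `HodgeCM/Model/ArchLeviFactorization.lean` (NEW additive leaf; imports sinst RUN-47 rows #1219 `Model/ArchLeviTransport` + #1220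
`Model/ArchCovariantSchur`; rowdeps #1219, #1220).
KERNEL only: 0 records / `def … : Prop` / cites-as-hypotheses, 0 proof holes; intended closure {propext, Classical.choice, Quot.sound}.
-/
import Summits.HodgeConjecture.HodgeCM.Model.ArchLeviTransport
import Summits.HodgeConjecture.HodgeCM.Model.ArchCovariantSchur

/-!
# (VT) reduced to a factorisation `h₀ = π(s h) · m` with `m` of Levi shape

The (J-μ) slots-2/3 input (VT) of #1217/#1218 asks that the archimedean factor `A_∞` of an implementer of the conjugated see-saw
element `h₀` (supplied with its tensor decomposition by (STRIP)) be a scalar multiple of `ω_∞(1, k) ∘ (Φ ↦ Φ ∘ P⁻¹)`.  This leaf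
assembles #1219 (W4: the Levi model operator is exactly `rhoSD`-covariant over `archPhaseMap` of a Levi-shaped element) and #1220
(W5: exactly covariant operators over the same phase map differ by a scalar; the read-off `archRepMp` is exactly covariant) into ONE
statement whose remaining hypotheses are group-theoretic:

* `compCLE P : 𝓢(D, ℂ) ≃L[ℂ] 𝓢(D, ℂ)`, `Φ ↦ Φ ∘ P⁻¹` (inverse `Φ ↦ Φ ∘ P`), and its covariance `compCLE_covariant_archPhaseMap` (#1219);
* **`exists_archFactor_eq_smul_archRepMp_compCLE`**: given
  (STRIP) an implementer `M` of `h₀` on `𝒮(𝔸^ι)` with tensor decomposition `M (Φ ⊗ f) = A Φ ⊗ M_f f` (`A` a continuous linear map,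
  `M_f f₀ ≠ 0`), a finite-trivial homomorphism `s : H →* Mp_ψ(W_𝔸)ᶜᵒⁿᵗ` and `h : H`, an element `m ∈ Sp(W_𝔸)` of LEVI SHAPE
  (`archAct T m (a, w) = (P a, Q w)`), and the FACTORISATION `h₀ = π(s h) * m`,
  THEN `∃ c : ℂ, ∀ Φ, A Φ = c • archRepMp s h (Φ ∘ P⁻¹)` — i.e. (VT) with `a := c`, modulo only (STRIP) and the factorisation
  (period-1's W1–W3: `m = toSp(1,k)⁻¹ h₀` is Levi with `P⁻¹ = 1_V ⊗ M` = theta-3's (K9) `conjFrameTransport`).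
* `…_ne_zero`: `c ≠ 0` as soon as `A Φ₀ ≠ 0` for one `Φ₀` (e.g. `A` an automorphism and `Φ₀ ≠ 0`).

Nothing here is specific to the see-saw datum; nothing is a claim of PerL/QW8; nothing is cited as a fact.

References: [Folland1989] G. B. Folland, *Harmonic Analysis in Phase Space*, Princeton UP 1989, Prop. (1.43), Prop. (1.50), (4.24).
-/

set_option autoImplicit false

noncomputable section

open scoped Matrix SchwartzMap TensorProduct Classical
open Complex NumberField NumberField.mixedEmbedding IsDedekindDomain
open Literature.NumberTheory.Automorphic Literature.RepresentationTheory.HeisenbergGroup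
open Literature.Analysis.SegalBargmann Literature.NumberTheory.Weil1964

namespace HodgeCM.Model.ArchLevi

/-! ## §1 The Levi model operator as a continuous linear AUTOMORPHISM -/

section CLE

variable {D : Type*} [NormedAddCommGroup D] [NormedSpace ℝ D]

/-- **`compCLE P : 𝓢(D, ℂ) ≃L[ℂ] 𝓢(D, ℂ)`, `Φ ↦ Φ ∘ P⁻¹`** (inverse `Φ ↦ Φ ∘ P`). [folklore] -/
def compCLE (P : D ≃L[ℝ] D) : 𝓢(D, ℂ) ≃L[ℂ] 𝓢(D, ℂ) :=
  ContinuousLinearEquiv.equivOfInverse (SchwartzMap.compCLMOfContinuousLinearEquiv ℂ P.symm)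
    (SchwartzMap.compCLMOfContinuousLinearEquiv ℂ P)
    (fun Φ => by ext x; simp) (fun Φ => by ext x; simp)

/-- Unfolding: `compCLE P Φ = compCLMOfContinuousLinearEquiv ℂ P⁻¹ Φ`. [folklore] -/
@[simp] theorem compCLE_apply (P : D ≃L[ℝ] D) (Φ : 𝓢(D, ℂ)) :
    compCLE P Φ = SchwartzMap.compCLMOfContinuousLinearEquiv ℂ P.symm Φ := rfl

/-- Pointwise: `compCLE P Φ x = Φ (P⁻¹ x)`. [folklore] -/
theorem compCLE_apply_apply (P : D ≃L[ℝ] D) (Φ : 𝓢(D, ℂ)) (x : D) : compCLE P Φ x = Φ (P.symm x) := rfl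

/-- Unfolding of the inverse: `(compCLE P)⁻¹ Φ = Φ ∘ P`. [folklore] -/
@[simp] theorem compCLE_symm_apply (P : D ≃L[ℝ] D) (Φ : 𝓢(D, ℂ)) :
    (compCLE P).symm Φ = SchwartzMap.compCLMOfContinuousLinearEquiv ℂ P Φ := rfl

end CLE

/-! ## §2 (VT) modulo (STRIP) and the Levi factorisation -/

section Factor

variable {F : Type} [Field F] [NumberField F] {ι : Type} [Fintype ι] [DecidableEq ι]
  {T : Matrix ι ι (AdeleRing (𝓞 F) F)} {H : Type*} [Group H]
  (hTy : Function.Surjective fun y : ι → AdeleRing (𝓞 F) F => T *ᵥ y) (s : H →* adelicMpCont F ι T)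
  (hfin : ∀ h, ∀ w ∈ finHeisenberg T,
    (ofSymplectic (polar (adelicForm F ι T)) (adelicMpCont.proj F ι T (s h))).act w = w)

/-- The Levi automorphism `compCLE P` is exactly `rhoSD`-covariant over `archPhaseMap T e hT m` for `m` of Levi shape `(P, Q)`
(#1219 `compCLM_symm_covariant_archPhaseMap`). [cite: Folland1989, Prop. (1.43), (4.24)] -/
theorem compCLE_covariant_archPhaseMap {σ : Type*} [Fintype σ] [DecidableEq σ]
    (e : (ι → mixedSpace F) ≃L[ℝ] (σ → ℝ)) (hT : IsUnit (archMat F ι T)) (m : symplecticGroup (polar (adelicForm F ι T)))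
    (P : (ι → mixedSpace F) ≃L[ℝ] (ι → mixedSpace F)) (Q : (ι → mixedSpace F) → (ι → mixedSpace F))
    (hP : ∀ a w, (archAct T m (a, w)).1 = P a) (hQ : ∀ a w, (archAct T m (a, w)).2 = Q w)
    (p q : σ → ℝ) (Φ : 𝓢((ι → mixedSpace F), ℂ)) :
    compCLE P (rhoSD e p q Φ) =
      rhoSD e (archPhaseMap T e hT m (p, q)).1 (archPhaseMap T e hT m (p, q)).2 (compCLE P Φ) :=
  compCLM_symm_covariant_archPhaseMap T e hT m P Q hP hQ p q Φ

/-- **(VT) MODULO (STRIP) AND THE LEVI FACTORISATION**: the archimedean factor `A` of an implementer of `h₀ = π(s h) · m`, `m` of Levi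
shape `(P, Q)`, is `c • ω_∞(h) ∘ (Φ ↦ Φ ∘ P⁻¹)`. [cite: Folland1989, Prop. (1.43), Prop. (1.50), (4.24)] -/
theorem exists_archFactor_eq_smul_archRepMp_compCLE {σ : Type*} [Fintype σ] [DecidableEq σ]
    (e : (ι → mixedSpace F) ≃L[ℝ] (σ → ℝ)) (hT : IsUnit (archMat F ι T))
    (h₀ : symplecticGroup (polar (adelicForm F ι T)))
    (M : piSchwartzBruhat F ι ≃ₗ[ℂ] piSchwartzBruhat F ι)
    (hM : Implements (adelicSchrodinger F ι T) (ofSymplectic (polar (adelicForm F ι T)) h₀) M)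
    (A : 𝓢((ι → mixedSpace F), ℂ) →L[ℂ] 𝓢((ι → mixedSpace F), ℂ)) (Mf : FinSB F ι →ₗ[ℂ] FinSB F ι)
    (hAM : ∀ (Φ : 𝓢((ι → mixedSpace F), ℂ)) (f : FinSB F ι),
      M (piSchwartzBruhatEquiv F ι (Φ ⊗ₜ f)) = piSchwartzBruhatEquiv F ι (A Φ ⊗ₜ Mf f))
    {f₀ : FinSB F ι} (hf₀ : Mf f₀ ≠ 0)
    (h : H) (m : symplecticGroup (polar (adelicForm F ι T)))
    (P : (ι → mixedSpace F) ≃L[ℝ] (ι → mixedSpace F)) (Q : (ι → mixedSpace F) → (ι → mixedSpace F))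
    (hP : ∀ a w, (archAct T m (a, w)).1 = P a) (hQ : ∀ a w, (archAct T m (a, w)).2 = Q w)
    (hfac : h₀ = adelicMpCont.proj F ι T (s h) * m) :
    ∃ c : ℂ, ∀ Φ : 𝓢((ι → mixedSpace F), ℂ), A Φ = c • archRepMp hTy s hfin h (compCLE P Φ) := by
  subst hfac
  have hA : ∀ (p q : σ → ℝ) (Φ : 𝓢((ι → mixedSpace F), ℂ)), A (rhoSD e p q Φ) =
      rhoSD e (archPhaseMap T e hT (adelicMpCont.proj F ι T (s h) * m) (p, q)).1
        (archPhaseMap T e hT (adelicMpCont.proj F ι T (s h) * m) (p, q)).2 (A Φ) := fun p q Φ =>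
    arch_covariant_rhoSD_exact T e hT _ M hM (A : 𝓢((ι → mixedSpace F), ℂ) →ₗ[ℂ] 𝓢((ι → mixedSpace F), ℂ)) Mf
      (fun Φ' f => hAM Φ' f) hf₀ p q Φ
  exact exists_eq_smul_comp_of_covariant_mul T e hT (adelicMpCont.proj F ι T (s h)) m A
    (archRepMpCLE hTy s hfin h) (compCLE P) hA (archRepMpCLE_rhoSD_exact hTy s hfin e hT h)
    (compCLE_covariant_archPhaseMap e hT m P Q hP hQ)

/-- … with `c ≠ 0` as soon as `A Φ₀ ≠ 0` for one `Φ₀`. [cite: Folland1989, Prop. (1.50)] -/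
theorem exists_archFactor_eq_smul_archRepMp_compCLE_ne_zero {σ : Type*} [Fintype σ] [DecidableEq σ]
    (e : (ι → mixedSpace F) ≃L[ℝ] (σ → ℝ)) (hT : IsUnit (archMat F ι T))
    (h₀ : symplecticGroup (polar (adelicForm F ι T)))
    (M : piSchwartzBruhat F ι ≃ₗ[ℂ] piSchwartzBruhat F ι)
    (hM : Implements (adelicSchrodinger F ι T) (ofSymplectic (polar (adelicForm F ι T)) h₀) M)
    (A : 𝓢((ι → mixedSpace F), ℂ) →L[ℂ] 𝓢((ι → mixedSpace F), ℂ)) (Mf : FinSB F ι →ₗ[ℂ] FinSB F ι)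
    (hAM : ∀ (Φ : 𝓢((ι → mixedSpace F), ℂ)) (f : FinSB F ι),
      M (piSchwartzBruhatEquiv F ι (Φ ⊗ₜ f)) = piSchwartzBruhatEquiv F ι (A Φ ⊗ₜ Mf f))
    {f₀ : FinSB F ι} (hf₀ : Mf f₀ ≠ 0)
    (h : H) (m : symplecticGroup (polar (adelicForm F ι T)))
    (P : (ι → mixedSpace F) ≃L[ℝ] (ι → mixedSpace F)) (Q : (ι → mixedSpace F) → (ι → mixedSpace F))
    (hP : ∀ a w, (archAct T m (a, w)).1 = P a) (hQ : ∀ a w, (archAct T m (a, w)).2 = Q w)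
    (hfac : h₀ = adelicMpCont.proj F ι T (s h) * m)
    {Φ₀ : 𝓢((ι → mixedSpace F), ℂ)} (hΦ₀ : A Φ₀ ≠ 0) :
    ∃ c : ℂ, c ≠ 0 ∧ ∀ Φ : 𝓢((ι → mixedSpace F), ℂ), A Φ = c • archRepMp hTy s hfin h (compCLE P Φ) := by
  obtain ⟨c, hc⟩ := exists_archFactor_eq_smul_archRepMp_compCLE hTy s hfin e hT h₀ M hM A Mf hAM hf₀ h m P Q hP hQ hfac
  refine ⟨c, fun h0 => hΦ₀ ?_, hc⟩
  rw [hc, h0, zero_smul]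

end Factor

end HodgeCM.Model.ArchLevi

end
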